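import Summits.HubbardSuperconductivity.HubbardSuperconductivity.Theorems.WcbcsSsbToTorusLRO.Negative.FacePurityDissection
import Summits.HubbardSuperconductivity.HubbardSuperconductivity.Theorems.ChiralWindowCwSsbToEvenTorusLROBlockSlope
import Summits.HubbardSuperconductivity.HubbardSuperconductivity.Theorems.ChiralWindowCwSsbToEvenTorusLROSourceRemoval
import Summits.HubbardSuperconductivity.HubbardSuperconductivity.Theorems.ChiralWindowCwSsbToEvenTorusLROSectorFloorGC
import Summits.HubbardSuperconductivity.HubbardSuperconductivity.Theorems.ChiralWindowCwSsbToEvenTorusLROCanonicalSupportingPotential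
import Literature.MathematicalPhysics.QuantumLattice.DWaveSource
import Literature.MathematicalPhysics.QuantumLattice.HubbardGrandCanonicalDensity
import HarnessLib

/-!
# Route `AposterioriCapRg` — crux `SsbToEvenTorusLro` (stmt-HubbardSuperconductivity-1315),
# line `pair-yrast-landau-floor`, stub `stub_facePurity`: REDUCTION to repelled-order persistence

The registered stub `stub_facePurity` of the line is DERIVATIVE FACE PURITY: under the crux hypotheses at
`(U, δ, μ)` (`U > 0`, `δ ∈ (0,1)`, grand-canonical density matching at `μ`, Koma–Tasaki `d`-wave order
`HasDWaveOrder U μ`) there is one `a > 0` such that at every block scale `R ≥ 1`, eventually along the even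
sides `2k+2`, EVERY normalised `(N_L, S^z = 0)`-sector ground state `ψ` of `hubbardTorus 2 L 1 U`
(`N_L = 2⌊(1-δ)L²/2⌋`) has block pair coherence `Re⟨ψ, W_R ψ⟩ ≥ a L²`, where
`W_R = R⁻⁴ Σ_x B_xᴴ B_x`, `B_x = Σ_{u ∈ [0,R)²} P_{x+u}`, `P_y = localPair dWaveFormFactor L y`.

Status of the stub. It is (i) NECESSARY for the crux — the landed
`WcbcsSsbToTorusLRO.Negative.deriv_of_hasDWavePairFieldLROAt` derives its consequent from the crux's consequent
`HasDWavePairFieldLROAt U δ` (`facePurity_of_hasDWavePairFieldLROAt` below; since the crux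
`AposterioriCapRg.SsbToEvenTorusLro` is `∀ U δ μ, 0 < U → δ ∈ Ioo 0 1 → DensityMatched → HasDWaveOrder U μ →
HasDWavePairFieldLROAt U δ` definitionally, `fun U δ μ hU hδ hdm hO => facePurity_of_hasDWavePairFieldLROAt
hδ.1.le (h U δ μ hU hδ hdm hO)` proves the stub's signature verbatim from the crux `h`) — and (ii) an
every-ground-state statement that no technique in the tree or in print proves today (the sibling crux
stmt-HubbardSuperconductivity-2009 PROMOTED the chord form of it). This file does NOT
prove the stub. It lands the sorry-free REDUCTION of the stub to ONE open physics statement, the window-free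
(`∀ U > 0`, `δ ∈ (0,1)`) form of the registered open stub `stub_repelledOrderPersistence` of the sibling line
`griffiths-block-slope` (crux `CwSsbToEvenTorusLRO`, stmt-HubbardSuperconductivity-10439): Koma–Tasaki `d`-wave
order of the block-REPELLED model `K_μ + κ(R)·W_R` with an `R`-uniform floor. That statement is OPEN PHYSICS and is
NOT filed as an item; here it only ever appears as an explicit hypothesis (`hBa`, `hB`).

Content (all on the literal route terms; no definition is introduced):

* `fp_canonical_gc_gap_recentre`, `fp_summitNumber_mem`, `fp_canonicalGCEquivalence_of_csp_of_densityMatched`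
  (Griffiths recentring: canonical/GC equivalence at the crux's own `μ` from the LANDED `T = 0` equivalence of
  ensembles `CwSsbToEvenTorusLRO.stub_canonicalSupportingPotential` at SOME `μ'` plus density matching at `μ`),
  `fp_repelled_chord_arith` (real bookkeeping) — adapted verbatim (fresh names) from the sibling crux workfile
  `Cruxes/CwSsbToEvenTorusLRO/Lines/griffiths_block_slope.lean`;
* `fp_chord_of_repelledOrderAt` — POINTWISE at `(U, δ, μ)`, `δ ∈ (0,1)`, no weak-coupling window: density
  matching + the repelled-order floor at `(U, μ)` ⇒ the CHORD form of face purity at `(U, δ)` (floor `a²/4`),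
  from the four LANDED theorems `CwSsbToEvenTorusLRO.stub_blockSlope` (S1), `stub_sourceRemoval` (S4),
  `stub_sectorFloorGC` (S5), `stub_canonicalSupportingPotential` (S3);
* `facePurity_of_repelledOrderAt` — chord ⇒ derivative by the LANDED `deriv_of_chord` (Danskin in the
  repulsive direction): the conclusion is EXACTLY the stub's consequent at `(U, δ)`;
* `stub_facePurity_of_repelledOrderPersistence` — the registered signature of `stub_facePurity`, VERBATIM, from
  the `∀ U > 0, δ ∈ (0,1)` repelled-order persistence hypothesis;
* `facePurity_of_hasDWavePairFieldLROAt` — necessity: the summit matrix at `(U, δ)` implies the stub's consequent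
  at `(U, δ)` (so the crux BY NAME implies the stub's full signature, one `fun` away; the route's Theses file is
  deliberately not imported here).

Folklore bookkeeping over the finite-dimensional variational principle (Tasaki 2020 §2.1–2.2; Ruelle 1969 §3.4
for the equivalence of ensembles, used only through the landed S3).
-/

noncomputable section

namespace Summit.HubbardSuperconductivity.HubbardSuperconductivity.Theorems

set_option linter.dupNamespace false

open Literature.MathematicalPhysics.QuantumLattice Literature.Probability.LatticeModels
open Literature.Barriers.HubbardSuperconductivity
open Filter Set Matrix
open scoped Matrix ComplexOrder
open _root_.Topology
open Summit.HubbardSuperconductivity.WcbcsSsbToTorusLRO.Negative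
  (deriv_of_chord deriv_of_hasDWavePairFieldLROAt exists_unit_groundStateInSector halfFilling_floor_le_sq)
open Summit.HubbardSuperconductivity.HubbardSuperconductivity.Theorems.CwSsbToEvenTorusLRO
  (stub_blockSlope stub_sourceRemoval stub_sectorFloorGC stub_canonicalSupportingPotential)

/-! ## Canonical/GC equivalence at the crux's own `μ` (Griffiths recentring)
Adapted, verbatim up to the fresh `fp_` names, from the sibling crux workfile
`Cruxes/CwSsbToEvenTorusLRO/Lines/griffiths_block_slope.lean` (prover-line-stmt-HubbardSuperconductivity-10439-0),
itself adapted from `Cruxes/WcbcsSsbToTorusLRO/Lines/quenched-corner-by-square-completion.lean` §1. -/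

-- adapted from Cruxes/CwSsbToEvenTorusLRO/Lines/griffiths_block_slope.lean (prover-line-stmt-HubbardSuperconductivity-10439-0)
/-- Recentring of the canonical/GC gap in the chemical potential: for real `E, N` and all `μ, μ'`,
`E − μN − E₀(K_μ) ≤ (E − μ'N − E₀(K_{μ'})) + (μ' − μ)(N − Re ω_{K_μ}(N̂))` (supergradient inequality
`sub_mul_gcNumber_le` of the concave `μ ↦ E₀(K_μ)`). [folklore] -/
theorem fp_canonical_gc_gap_recentre (L : ℕ) (U μ μ' E N : ℝ) :
    E - μ * N - (hubbardTorusWith 2 L 1 U μ).groundEnergy ≤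
      (E - μ' * N - (hubbardTorusWith 2 L 1 U μ').groundEnergy) +
        (μ' - μ) * (N - ((hubbardTorusWith 2 L 1 U μ).groundStateFunctional totalNumber).re) := by
  have h : (μ' - μ) * ((hubbardTorusWith 2 L 1 U μ).groundStateFunctional totalNumber).re ≤
      (hubbardTorusWith 2 L 1 U μ).groundEnergy - (hubbardTorusWith 2 L 1 U μ').groundEnergy := by
    have h := sub_mul_gcNumber_le (fermionTorusGraph 2 L) 1 U μ μ'
    unfold hubbardTorusWith
    convert h
  nlinarith [h]

-- adapted from Cruxes/CwSsbToEvenTorusLRO/Lines/griffiths_block_slope.lean (prover-line-stmt-HubbardSuperconductivity-10439-0)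
/-- `(1-δ)L² − 2 < N_L ≤ (1-δ)L²` for `δ ≤ 1`, `N_L = 2⌊(1-δ)L²/2⌋`. [folklore] -/
theorem fp_summitNumber_mem (L : ℕ) {δ : ℝ} (hδ : δ ≤ 1) :
    (1 - δ) * (L : ℝ) ^ 2 - 2 < ((2 * ⌊(1 - δ) * (L : ℝ) ^ 2 / 2⌋₊ : ℕ) : ℝ) ∧
      ((2 * ⌊(1 - δ) * (L : ℝ) ^ 2 / 2⌋₊ : ℕ) : ℝ) ≤ (1 - δ) * (L : ℝ) ^ 2 := by
  have hx : 0 ≤ (1 - δ) * (L : ℝ) ^ 2 / 2 := by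
    have : (0 : ℝ) ≤ 1 - δ := by linarith
    positivity
  have h1 := Nat.floor_le hx
  have h2 := Nat.lt_floor_add_one ((1 - δ) * (L : ℝ) ^ 2 / 2)
  push_cast
  constructor <;> linarith

-- adapted from Cruxes/CwSsbToEvenTorusLRO/Lines/griffiths_block_slope.lean (prover-line-stmt-HubbardSuperconductivity-10439-0)
/-- **Source-free canonical/GC equivalence at the crux's own `μ`** from a supporting potential `μ'` (the shape
of the landed `stub_canonicalSupportingPotential`, as a hypothesis) and density matching at `μ`:
`E_sec(N_L) − μN_L − E₀(K_μ) ≤ εL²` eventually along even `L` (recentring plus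
`|N_L − Re ω_{K_μ}(N̂)| ≤ 2 + o(L²)`). [folklore] -/
theorem fp_canonicalGCEquivalence_of_csp_of_densityMatched {U δ μ : ℝ} (hδ : δ ≤ 1)
    (hCSP : ∃ μ' : ℝ, ∀ ε : ℝ, 0 < ε → ∃ L₀ : ℕ, ∀ L : ℕ, Even L → L₀ ≤ L →
      |(hubbardTorus 2 L 1 U).minEnergyOn (szSector (2 * ⌊(1 - δ) * (L : ℝ) ^ 2 / 2⌋₊) 0) -
          μ' * ((2 * ⌊(1 - δ) * (L : ℝ) ^ 2 / 2⌋₊ : ℕ) : ℝ) -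
            Matrix.groundEnergy (hubbardTorusWith 2 L 1 U μ')| ≤ ε * (L : ℝ) ^ 2)
    (hDM : Filter.Tendsto (fun L : ℕ => ((hubbardTorusWith 2 (L + 1) 1 U μ).groundStateFunctional totalNumber).re / ((L + 1 : ℕ) : ℝ) ^ 2) Filter.atTop (nhds (1 - δ))) :
    ∀ ε : ℝ, 0 < ε → ∃ L₀ : ℕ, ∀ L : ℕ, L₀ ≤ L → Even L →
      (hubbardTorus 2 L 1 U).minEnergyOn (szSector (2 * ⌊(1 - δ) * (L : ℝ) ^ 2 / 2⌋₊) 0) -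
          μ * ((2 * ⌊(1 - δ) * (L : ℝ) ^ 2 / 2⌋₊ : ℕ) : ℝ) - (hubbardTorusWith 2 L 1 U μ).groundEnergy ≤
        ε * (L : ℝ) ^ 2 := by
  intro ε hε
  obtain ⟨μ', hμ'⟩ := hCSP
  set C : ℝ := |μ' - μ| with hC_def
  have hC : 0 ≤ C := abs_nonneg _
  obtain ⟨L₁, hL₁⟩ := hμ' (ε / 2) (by positivity)
  set ε₂ : ℝ := ε / (4 * (C + 1)) with hε₂_def
  have hC1 : 0 < C + 1 := by linarith
  have hε₂ : 0 < ε₂ := by positivity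
  obtain ⟨L₂, hL₂⟩ := Metric.tendsto_atTop.1 hDM ε₂ hε₂
  obtain ⟨L₃, hL₃⟩ := exists_nat_ge (2 / ε₂)
  refine ⟨max L₁ (max (L₂ + 1) (L₃ + 1)), fun L hL hev => ?_⟩
  have hL1 : L₁ ≤ L := le_of_max_le_left hL
  have hL2 : L₂ + 1 ≤ L := (le_max_left _ _).trans (le_of_max_le_right hL)
  have hL3 : L₃ + 1 ≤ L := (le_max_right _ _).trans (le_of_max_le_right hL)
  obtain ⟨n, rfl⟩ : ∃ n, L = n + 1 := ⟨L - 1, by omega⟩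
  set Lr : ℝ := ((n + 1 : ℕ) : ℝ) with hLr
  have hLr1 : 1 ≤ Lr := by rw [hLr]; exact_mod_cast (by omega : 1 ≤ n + 1)
  have hLpos : 0 < Lr := by linarith
  have hL2pos : (0 : ℝ) < Lr ^ 2 := by positivity
  have hd := hL₂ n (by omega)
  rw [Real.dist_eq] at hd
  set nL : ℝ := ((hubbardTorusWith 2 (n + 1) 1 U μ).groundStateFunctional totalNumber).re with hnL
  have hd' : |nL - (1 - δ) * Lr ^ 2| < ε₂ * Lr ^ 2 := by
    have e : nL - (1 - δ) * Lr ^ 2 = (nL / Lr ^ 2 - (1 - δ)) * Lr ^ 2 := by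
      field_simp
    rw [e, abs_mul, abs_of_pos hL2pos]
    exact mul_lt_mul_of_pos_right hd hL2pos
  obtain ⟨hN1, hN2⟩ := fp_summitNumber_mem (n + 1) hδ
  have h2le : 2 ≤ ε₂ * Lr ^ 2 := by
    have hL3r : (L₃ : ℝ) ≤ Lr := by rw [hLr]; exact_mod_cast (by omega : L₃ ≤ n + 1)
    have h1 : 2 / ε₂ ≤ Lr := hL₃.trans hL3r
    rw [div_le_iff₀ hε₂] at h1
    nlinarith
  have hcsp := (le_abs_self _).trans (hL₁ (n + 1) hev hL1)
  have hrec := fp_canonical_gc_gap_recentre (n + 1) U μ μ'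
    ((hubbardTorus 2 (n + 1) 1 U).minEnergyOn (szSector (2 * ⌊(1 - δ) * Lr ^ 2 / 2⌋₊) 0))
    (((2 * ⌊(1 - δ) * Lr ^ 2 / 2⌋₊ : ℕ) : ℝ))
  have habs : |((2 * ⌊(1 - δ) * Lr ^ 2 / 2⌋₊ : ℕ) : ℝ) - nL| ≤ 2 * ε₂ * Lr ^ 2 := by
    rw [abs_le]
    obtain ⟨hd1, hd2⟩ := abs_lt.1 hd'
    constructor <;> linarith
  have hprod : (μ' - μ) * (((2 * ⌊(1 - δ) * Lr ^ 2 / 2⌋₊ : ℕ) : ℝ) - nL) ≤ C * (2 * ε₂ * Lr ^ 2) :=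
    calc (μ' - μ) * (((2 * ⌊(1 - δ) * Lr ^ 2 / 2⌋₊ : ℕ) : ℝ) - nL)
        ≤ |(μ' - μ) * (((2 * ⌊(1 - δ) * Lr ^ 2 / 2⌋₊ : ℕ) : ℝ) - nL)| := le_abs_self _
      _ = C * |((2 * ⌊(1 - δ) * Lr ^ 2 / 2⌋₊ : ℕ) : ℝ) - nL| := by rw [abs_mul]
      _ ≤ C * (2 * ε₂ * Lr ^ 2) := mul_le_mul_of_nonneg_left habs hC
  have hCε : C * (2 * ε₂) ≤ ε / 2 := by
    have e : C * (2 * ε₂) = ε / 2 * (C / (C + 1)) := by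
      rw [hε₂_def]
      field_simp
      ring
    rw [e]
    have : C / (C + 1) ≤ 1 := (div_le_one hC1).2 (by linarith)
    nlinarith
  have hCε' : C * (2 * ε₂ * Lr ^ 2) ≤ ε / 2 * Lr ^ 2 := by nlinarith
  linarith

/-! ## The chord form of face purity from S1 + repelled order + S4 + S5 + CGE -/

-- adapted from Cruxes/CwSsbToEvenTorusLRO/Lines/griffiths_block_slope.lean (prover-line-stmt-HubbardSuperconductivity-10439-0)
/-- Real bookkeeping of the Griffiths block slope on one side (`A = L²`): `Ehκ, Eh0` the sourced GC energies at
block couplings `κ, 0`; `E0κ, E00` the source-free ones; `Sκ, S0` the sector energies of `H + κW_R`, `H` at `N_L`;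
`x` the sourced tracial pair amplitude of the repelled model. Inputs in order: S1 (with `t = κ`), the repelled-order
floor, S4 twice, S5, CGE, the choice of `h`. Output: the chord floor `κ (a²/4) A ≤ Sκ − S0`. [folklore] -/
theorem fp_repelled_chord_arith {Ehκ Eh0 E0κ E00 Sκ S0 x A a κ h μN ε : ℝ}
    (hS1 : Eh0 - Ehκ ≤ -κ * x ^ 2 / A) (hS2 : a ≤ x / A) (ha : 0 < a) (hA : 0 < A) (hκ : 0 < κ)
    (hS4a : |Ehκ - E0κ| ≤ 12 * h * A) (hS4b : |Eh0 - E00| ≤ 12 * h * A)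
    (hS5 : E0κ ≤ Sκ - μN) (hcge : S0 - μN - E00 ≤ ε * A)
    (hh : 24 * (12 * h) ≤ κ * a ^ 2) (hε : ε = κ * a ^ 2 / 4) :
    κ * (a ^ 2 / 4) * A ≤ Sκ - S0 := by
  have hx : a * A ≤ x := (le_div_iff₀ hA).mp hS2
  have haA : 0 ≤ a * A := by positivity
  have hx2 : (a * A) ^ 2 ≤ x ^ 2 := pow_le_pow_left₀ haA hx 2
  have h1 : κ * a ^ 2 * A ≤ κ * x ^ 2 / A := by
    rw [le_div_iff₀ hA]
    calc κ * a ^ 2 * A * A = κ * (a * A) ^ 2 := by ring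
      _ ≤ κ * x ^ 2 := mul_le_mul_of_nonneg_left hx2 hκ.le
  have hneg : -κ * x ^ 2 / A = -(κ * x ^ 2 / A) := by ring
  have hgap : κ * a ^ 2 * A ≤ Ehκ - Eh0 := by
    rw [hneg] at hS1
    linarith
  have h4a := abs_le.mp hS4a
  have h4b := abs_le.mp hS4b
  have hhA : 24 * (12 * h) * A ≤ κ * a ^ 2 * A := mul_le_mul_of_nonneg_right hh hA.le
  subst hε
  linarith [h4a.1, h4a.2, h4b.1, h4b.2]

-- adapted from Cruxes/CwSsbToEvenTorusLRO/Lines/griffiths_block_slope.lean (prover-line-stmt-HubbardSuperconductivity-10439-0)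
/-- **Pointwise chord from repelled order (sorry-free).** At one parameter `(U, δ, μ)` with `δ ∈ (0,1)` and NO
weak-coupling window: grand-canonical density matching at `μ` and an `R`-uniform repelled-order floor at `(U, μ)`
(the body of the sibling line's open stub `stub_repelledOrderPersistence` at `(U, μ)`, as a HYPOTHESIS) give the
CHORD form of face purity at `(U, δ)` with floor `a²/4`: for every block scale `R ≥ 1` some `κ > 0` with
`κ (a²/4) L² ≤ E_sec(H + κW_R)(N_L, 0) − E_sec(H)(N_L, 0)` eventually along even sides — from the LANDED
`stub_blockSlope` (S1, step `t = κ`), `stub_sourceRemoval` (S4, at `κ` and at `0`, source `h ≤ κa²/288`),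
`stub_sectorFloorGC` (S5), `stub_canonicalSupportingPotential` (S3) and the recentring lemma. [folklore] -/
theorem fp_chord_of_repelledOrderAt {U δ μ : ℝ} (hδ : δ ∈ Set.Ioo (0:ℝ) 1)
    (hdm : Filter.Tendsto (fun L : ℕ => ((hubbardTorusWith 2 (L + 1) 1 U μ).groundStateFunctional totalNumber).re / ((L + 1 : ℕ) : ℝ) ^ 2) Filter.atTop (nhds (1 - δ)))
    (hBa : ∃ a : ℝ, 0 < a ∧ ∀ R : ℕ, 0 < R → ∃ κ : ℝ, 0 < κ ∧ ∃ h₀ : ℝ, 0 < h₀ ∧ ∀ h ∈ Set.Ioo (0:ℝ) h₀, ∀ᶠ L : ℕ in Filter.atTop, a ≤ ((dWaveSourceTorus (L + 1) U μ h + (κ : ℂ) • (((((R : ℝ) ^ 4)⁻¹ : ℝ) : ℂ) • ∑ a : Literature.Probability.LatticeModels.TorusSite 2 (L + 1), (∑ u : Fin 2 → Fin R, localPair dWaveFormFactor (L + 1) (a + fun i => ((u i : ℕ) : ZMod (L + 1))))ᴴ * (∑ u : Fin 2 → Fin R, localPair dWaveFormFactor (L + 1) (a + fun i => ((u i : ℕ)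 : ZMod (L + 1)))))).groundStateFunctional (pairField dWaveFormFactor (L + 1))).re / ((L + 1 : ℕ) : ℝ) ^ 2) :
    (∃ a : ℝ, 0 < a ∧ ∀ R : ℕ, 0 < R → ∃ κ : ℝ, 0 < κ ∧ ∀ᶠ k : ℕ in Filter.atTop,
    κ * a * ((2 * k + 1 + 1 : ℕ) : ℝ) ^ 2 ≤
      (hubbardTorus 2 (2 * k + 1 + 1) 1 U + (κ : ℂ) • (((((R : ℝ) ^ 4)⁻¹ : ℝ) : ℂ) • ∑ a : Literature.Probability.LatticeModels.TorusSite 2 (2 * k + 1 + 1), ((∑ u : Fin 2 → Fin R, localPair dWaveFormFactor ((2 * k + 1 + 1)) (a + fun i => ((u i : ℕ) : ZMod ((2 * k + 1 + 1))))))ᴴ * ((∑ u : Fin 2 → Fin R, localPair dWaveFormFactor ((2 * k + 1 + 1)) (a + fun i => ((u i : ℕ) : ZMod ((2 * k + 1 + 1)))))))).minEnergyOn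
          (szSector (2 * ⌊(1 - δ) * (((2 * k + 1 + 1) : ℕ) : ℝ) ^ 2 / 2⌋₊) 0) -
        (hubbardTorus 2 (2 * k + 1 + 1) 1 U).minEnergyOn (szSector (2 * ⌊(1 - δ) * (((2 * k + 1 + 1) : ℕ) : ℝ) ^ 2 / 2⌋₊) 0)) := by
  obtain ⟨a, ha, hBa⟩ := hBa
  have hδ1 : δ ≤ 1 := hδ.2.le
  have hδ0 : 0 ≤ δ := hδ.1.le
  have hcge := fp_canonicalGCEquivalence_of_csp_of_densityMatched (U := U) (μ := μ) hδ1
    (stub_canonicalSupportingPotential U δ hδ) hdm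
  refine ⟨a ^ 2 / 4, by positivity, fun R hR => ?_⟩
  obtain ⟨κ, hκ, h₀, hh₀, hBκ⟩ := hBa R hR
  refine ⟨κ, hκ, ?_⟩
  -- the source strength
  set h : ℝ := min (h₀ / 2) (κ * a ^ 2 / 288) with hh_def
  have hhpos : 0 < h := lt_min (by positivity) (by positivity)
  have hhIoo : h ∈ Set.Ioo (0:ℝ) h₀ := ⟨hhpos, lt_of_le_of_lt (min_le_left _ _) (by linarith)⟩
  have hh288 : 24 * (12 * h) ≤ κ * a ^ 2 := by
    have : h ≤ κ * a ^ 2 / 288 := min_le_right _ _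
    linarith
  -- repelled order on the even sides (the odd numbers `2k+1` tend to infinity), CGE at resolution κa²/4
  have h21 : Tendsto (fun k : ℕ => 2 * k + 1) atTop atTop := by
    refine tendsto_atTop_mono (fun k => ?_) tendsto_id
    simp only [id]; omega
  have hBk := h21.eventually (hBκ h hhIoo)
  obtain ⟨L₁, hL₁⟩ := hcge (κ * a ^ 2 / 4) (by positivity)
  filter_upwards [hBk, eventually_ge_atTop L₁] with k hk hkL
  have hEven : Even (2 * k + 1 + 1) := ⟨k + 1, by ring⟩
  have hL₁' : L₁ ≤ 2 * k + 1 + 1 := by omega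
  have hcgek := hL₁ (2 * k + 1 + 1) hL₁' hEven
  -- S1 with base point κ and step t = κ
  have hS1 := stub_blockSlope (2 * k + 1 + 1) R hR U μ h κ κ hκ.le
  rw [sub_self, Complex.ofReal_zero, zero_smul, add_zero] at hS1
  -- S4 at κ and at 0
  have hS4a := stub_sourceRemoval (2 * k + 1 + 1) R U μ h κ
  have hS4b := stub_sourceRemoval (2 * k + 1 + 1) R U μ h 0
  rw [Complex.ofReal_zero, zero_smul, add_zero, add_zero] at hS4b
  rw [abs_of_pos hhpos] at hS4a hS4b
  -- S5 in the sector N_L (non-empty)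
  have hne : ∃ φ : Fock (Orb (FermionTorus 2 (2 * k + 1 + 1))),
      φ ∈ szSector (2 * ⌊(1 - δ) * (((2 * k + 1 + 1 : ℕ) : ℝ)) ^ 2 / 2⌋₊) 0 ∧ φ ≠ 0 := by
    obtain ⟨ψ, -, hψ⟩ := exists_unit_groundStateInSector (2 * k + 1 + 1) U
      (halfFilling_floor_le_sq (2 * k + 1 + 1) hδ0)
    exact ⟨ψ, hψ.1, hψ.2.1⟩
  have hS5 := stub_sectorFloorGC (2 * k + 1 + 1) R U μ κ _ hne
  have hA : (0 : ℝ) < (((2 * k + 1 + 1 : ℕ) : ℝ)) ^ 2 := by positivity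
  exact fp_repelled_chord_arith hS1 hk ha hA hκ hS4a hS4b hS5 hcgek hh288 rfl

/-! ## Derivative face purity (the stub's consequent) from repelled order -/

/-- **Derivative face purity at `(U, δ)` from repelled order at `(U, μ)` (sorry-free reduction, pointwise, no
window).** For `δ ∈ (0,1)`: grand-canonical density matching at `μ` and the `R`-uniform repelled-order floor at
`(U, μ)` — the body at `(U, μ)` of the sibling line's OPEN stub `stub_repelledOrderPersistence` (crux
`CwSsbToEvenTorusLRO`, stmt-HubbardSuperconductivity-10439: Koma–Tasaki `d`-wave order of the block-REPELLED model
`K_μ + κ(R)·W_R`, floor `a` uniform in the block scale `R`), taken as an explicit HYPOTHESIS — imply EXACTLY the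
consequent of the registered stub `stub_facePurity` at `(U, δ)`: one `a' > 0` (`= a²/4`) such that at every scale
`R ≥ 1`, eventually along even sides, every normalised `(N_L, S^z = 0)`-sector ground state has block pair
coherence `Re⟨ψ, W_R ψ⟩ ≥ a' L²`. Proof: `fp_chord_of_repelledOrderAt`, then the LANDED `deriv_of_chord`
(Danskin in the repulsive direction). [folklore] -/
theorem facePurity_of_repelledOrderAt {U δ μ : ℝ} (hδ : δ ∈ Set.Ioo (0:ℝ) 1)
    (hdm : Filter.Tendsto (fun L : ℕ => ((hubbardTorusWith 2 (L + 1) 1 U μ).groundStateFunctional totalNumber).re / ((L + 1 : ℕ) : ℝ) ^ 2) Filter.atTop (nhds (1 - δ)))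
    (hBa : ∃ a : ℝ, 0 < a ∧ ∀ R : ℕ, 0 < R → ∃ κ : ℝ, 0 < κ ∧ ∃ h₀ : ℝ, 0 < h₀ ∧ ∀ h ∈ Set.Ioo (0:ℝ) h₀, ∀ᶠ L : ℕ in Filter.atTop, a ≤ ((dWaveSourceTorus (L + 1) U μ h + (κ : ℂ) • (((((R : ℝ) ^ 4)⁻¹ : ℝ) : ℂ) • ∑ a : Literature.Probability.LatticeModels.TorusSite 2 (L + 1), (∑ u : Fin 2 → Fin R, localPair dWaveFormFactor (L + 1) (a + fun i => ((u i : ℕ) : ZMod (L + 1))))ᴴ * (∑ u : Fin 2 → Fin R, localPair dWaveFormFactor (L + 1) (a + fun i => ((u i : ℕ) : ZMod (L + 1)))))).groundStateFunctional (pairField dWaveFormFactor (L + 1))).re / ((L + 1 : ℕ) : ℝ) ^ 2) :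
    ∃ a : ℝ, 0 < a ∧ ∀ R : ℕ, 0 < R → ∀ᶠ k : ℕ in Filter.atTop, ∀ ψ : Fock (Orb (FermionTorus 2 (2 * k + 1 + 1))), IsGroundStateInSector (hubbardTorus 2 (2 * k + 1 + 1) 1 U) (2 * ⌊(1 - δ) * ((2 * k + 1 + 1 : ℕ) : ℝ) ^ 2 / 2⌋₊) 0 ψ → star ψ ⬝ᵥ ψ = 1 → a * ((2 * k + 1 + 1 : ℕ) : ℝ) ^ 2 ≤ (star ψ ⬝ᵥ ((((((R : ℝ) ^ 4)⁻¹ : ℝ) : ℂ) • ∑ x : TorusSite 2 (2 * k + 1 + 1), (∑ u : Fin 2 → Fin R, localPair dWaveFormFactor (2 * k + 1 + 1) (x + fun i => ((u i : ℕ) : ZMod (2 * k + 1 + 1))))ᴴ * (∑ u : Fin 2 → Fin R, localPair dWaveFormFactor (2 * k + 1 + 1) (x + fun i => ((u i : ℕ) : ZMod (2 * k + 1 + 1))))) *ᵥ ψ)).re :=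
  deriv_of_chord (fp_chord_of_repelledOrderAt hδ hdm hBa)

/-- **The registered stub `stub_facePurity` from repelled-order persistence (sorry-free reduction).** The
antecedent is the `∀ U > 0, δ ∈ (0,1)` (window-free) form of the registered OPEN stub
`stub_repelledOrderPersistence` of the sibling line `griffiths-block-slope` (crux `CwSsbToEvenTorusLRO`,
stmt-HubbardSuperconductivity-10439): under the crux hypotheses at `(U, δ, μ)`, Koma–Tasaki `d`-wave order of the
block-REPELLED model `K_μ + κ(R)·W_R` with an `R`-uniform floor (`L → ∞` first, then all small sources `h`). It is
an OPEN PHYSICS statement, NOT filed as an item, and appears here only as the antecedent. The consequent is the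
registered signature of `stub_facePurity` (line `pair-yrast-landau-floor`, crux `SsbToEvenTorusLro`,
stmt-HubbardSuperconductivity-1315) VERBATIM — derivative face purity, which is NECESSARY for that crux
(`facePurity_of_hasDWavePairFieldLROAt`, from the landed `deriv_of_hasDWavePairFieldLROAt`). [folklore] -/
theorem stub_facePurity_of_repelledOrderPersistence :
    (∀ (U δ μ : ℝ), 0 < U → δ ∈ Set.Ioo (0:ℝ) 1 → Filter.Tendsto (fun L : ℕ => ((hubbardTorusWith 2 (L + 1) 1 U μ).groundStateFunctional totalNumber).re / ((L + 1 : ℕ) : ℝ) ^ 2) Filter.atTop (nhds (1 - δ)) → HasDWaveOrder U μ → ∃ a : ℝ, 0 < a ∧ ∀ R : ℕ, 0 < R → ∃ κ : ℝ, 0 < κ ∧ ∃ h₀ : ℝ, 0 < h₀ ∧ ∀ h ∈ Set.Ioo (0:ℝ) h₀, ∀ᶠ L : ℕ in Filter.atTop, a ≤ ((dWaveSourceTorus (L + 1) U μ h + (κ : ℂ) • (((((R : ℝ) ^ 4)⁻¹ : ℝ) : ℂ) • ∑ a : Literature.Probability.LatticeModels.TorusSite 2 (L + 1), (∑ u : Fin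 2 → Fin R, localPair dWaveFormFactor (L + 1) (a + fun i => ((u i : ℕ) : ZMod (L + 1))))ᴴ * (∑ u : Fin 2 → Fin R, localPair dWaveFormFactor (L + 1) (a + fun i => ((u i : ℕ) : ZMod (L + 1)))))).groundStateFunctional (pairField dWaveFormFactor (L + 1))).re / ((L + 1 : ℕ) : ℝ) ^ 2) → ∀ (U δ μ : ℝ), 0 < U → δ ∈ Set.Ioo (0:ℝ) 1 → Filter.Tendsto (fun L : ℕ => ((hubbardTorusWith 2 (L + 1) 1 U μ).groundStateFunctional totalNumber).re / ((L + 1 : ℕ) : ℝ) ^ 2) Filter.atTop (nhds (1 - δ)) → HasDWaveOrder U μ → ∃ a : ℝ, 0 < a ∧ ∀ R : ℕ, 0 < R → ∀ᶠ k : ℕ in Filter.atTop, ∀ ψ : Fock (Orb (FermionTorus 2 (2 * k + 1 + 1))), IsGroundStateInSector (hubbardTorus 2 (2 * k + 1 + 1) 1 U) (2 * ⌊(1 - δ) * ((2 * k + 1 + 1 : ℕ) : ℝ) ^ 2 / 2⌋₊) 0 ψ → star ψ ⬝ᵥ ψ = 1 → a * ((2 * k + 1 + 1 : ℕ) : ℝ)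 ^ 2 ≤ (star ψ ⬝ᵥ ((((((R : ℝ) ^ 4)⁻¹ : ℝ) : ℂ) • ∑ x : TorusSite 2 (2 * k + 1 + 1), (∑ u : Fin 2 → Fin R, localPair dWaveFormFactor (2 * k + 1 + 1) (x + fun i => ((u i : ℕ) : ZMod (2 * k + 1 + 1))))ᴴ * (∑ u : Fin 2 → Fin R, localPair dWaveFormFactor (2 * k + 1 + 1) (x + fun i => ((u i : ℕ) : ZMod (2 * k + 1 + 1))))) *ᵥ ψ)).re :=
  fun hB U δ μ hU hδ hdm hO => facePurity_of_repelledOrderAt hδ hdm (hB U δ μ hU hδ hdm hO)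

/-! ## Necessity: the summit matrix at `(U, δ)` forces the stub's consequent -/

/-- **The summit matrix at `(U, δ)` forces the stub's consequent** (`δ ≥ 0`): the every-ground-state
block-coherence floor at all scales is NECESSARY for `HasDWavePairFieldLROAt U δ` — the landed
`deriv_of_hasDWavePairFieldLROAt`, restated on the stub's literal consequent. [folklore] -/
theorem facePurity_of_hasDWavePairFieldLROAt {U δ : ℝ} (hδ : 0 ≤ δ) (h : HasDWavePairFieldLROAt U δ) :
    ∃ a : ℝ, 0 < a ∧ ∀ R : ℕ, 0 < R → ∀ᶠ k : ℕ in Filter.atTop, ∀ ψ : Fock (Orb (FermionTorus 2 (2 * k + 1 + 1))), IsGroundStateInSector (hubbardTorus 2 (2 * k + 1 + 1) 1 U) (2 * ⌊(1 - δ) * ((2 * k + 1 + 1 : ℕ) : ℝ) ^ 2 / 2⌋₊) 0 ψ → star ψ ⬝ᵥ ψ = 1 → a * ((2 * k + 1 + 1 : ℕ) : ℝ) ^ 2 ≤ (star ψ ⬝ᵥ ((((((R : ℝ) ^ 4)⁻¹ : ℝ) : ℂ) • ∑ x : TorusSite 2 (2 * k + 1 + 1), (∑ u : Fin 2 → Fin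 R, localPair dWaveFormFactor (2 * k + 1 + 1) (x + fun i => ((u i : ℕ) : ZMod (2 * k + 1 + 1))))ᴴ * (∑ u : Fin 2 → Fin R, localPair dWaveFormFactor (2 * k + 1 + 1) (x + fun i => ((u i : ℕ) : ZMod (2 * k + 1 + 1))))) *ᵥ ψ)).re :=
  deriv_of_hasDWavePairFieldLROAt hδ h

end Summit.HubbardSuperconductivity.HubbardSuperconductivity.Theorems

end
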